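import Literature.NumberTheory.GaloisRepresentations.MackeyInducedIrreducible
import Literature.NumberTheory.GaloisRepresentations.ResidualRepUnique
import Literature.NumberTheory.GaloisRepresentations.ResidualRepScalarExtension
import Literature.NumberTheory.GaloisRepresentations.ResidualGaloisRepOpenKernel
import Literature.NumberTheory.GaloisRepresentations.StableLatticeValuationRing
import Literature.NumberTheory.GaloisRepresentations.AbsolutelyIrreducibleReduction
import Literature.RepresentationTheory.Semisimple.IrreducibleOfCharpoly
import HarnessLib

/-!
# Residual absolute irreducibility of a quadratic induction restricted to `Γ_L`
# (`(Ind_{Γ_E}^{Γ_K} W)|_{Γ_L}` with `W̄` absolutely irreducible on `Γ_{EL}` and `W̄ ≄ W̄^c` there)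

Topic `Literature/NumberTheory/GaloisRepresentations`.  Theorem-only file (no named fact, no new
notion).  It supplies the residual (`IsResiduallyAbsIrreducible`, `ResidualGaloisRep`) bookkeeping
on top of the matrix-form Mackey criterion `MackeyInducedIrreducible`, in the shape of hypothesis
(4) "`(Ind_{G_E}^{G_K} r̄)|_{G_{K(ζ_l)}}` absolutely irreducible" of the potential-automorphy
theorems for a twisted quadratic induction (Barnet-Lamb–Gee–Geraghty–Taylor 2014, Thm. C):

* `IsReductionOf.isAbsIrreducible_of_isResiduallyAbsIrreducible` — **every reduction of a
  residually absolutely irreducible `ρ` is absolutely irreducible**: two reductions have the same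
  characteristic polynomials (`HasResidualCharpolys.charpoly_eq`), and irreducibility of a matrix
  representation is detected by characteristic polynomials
  (`Literature.RepresentationTheory.Semisimple.isIrreducible_of_charpoly_eq`, the Brauer–Nesbitt
  circle of ideas; no semisimplicity of the reduction is needed).
* `FramedGaloisRep.exists_isReductionOf_induce` — **`Ind` commutes with reduction**: for
  `W : Γ_E → GL_n(ℚ̄_p)` there is a continuous reduction `τ : Γ_E → GL_n(ℤ̄_p/𝔪)` (discrete
  topology; Deligne–Serre: reductions have open kernel, `isOpen_ker_of_isReductionOf`) such that
  `Ind_{Γ_E}^{Γ_K} τ` (`FramedGaloisRep.induce`, same coset representatives) is a reduction of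
  `Ind_{Γ_E}^{Γ_K} W`: an integral model `W₀ = P⁻¹ W P` (`exists_integralModel_of_valuationSubring`)
  induces to an integral model `Ind(W₀) = D⁻¹ Ind(W) D` (`indMatrix_map`, `FramedRep.induce_conj`),
  whose reduction is `Ind(W₀ mod 𝔪)`.
* `FramedGaloisRep.isResiduallyAbsIrreducible_restrictField_induce_of_finrank_eq_two` — **for a
  quadratic Galois `E/K`, `L/K` with `res(Γ_L)` normal and `L ⊄ E`, and `M/E` presenting `Γ_{EL}`
  (`res(Γ_M) = res⁻¹(res Γ_L)`), if `W|_{Γ_M}` is residually absolutely irreducible and `W|_{Γ_M}`,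
  `W^g|_{Γ_M}` (`g ∉ res Γ_E`) are NOT residually congruent (`FramedRep.IsResiduallyCongruent`: their
  reductions have different characteristic polynomials somewhere), then `(Ind_{Γ_E}^{Γ_K} W)|_{Γ_L}`
  is residually absolutely irreducible** (Mackey,
  `isAbsolutelyIrreducible_restrictField_induce_of_finrank_eq_two`, applied to the reduction `τ`).

## References

* J.-P. Serre, *Linear representations of finite groups*, GTM 42 (1977), §7.4 Cor.
  [SerreLinearRepresentations1977]
* H. Darmon, F. Diamond, R. Taylor, *Fermat's Last Theorem* (1995), §2.1 (reductions, Prop. 2.6).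
  [DarmonDiamondTaylor1995]
* T. Barnet-Lamb, T. Gee, D. Geraghty, R. Taylor, *Potential automorphy and change of weight*,
  Ann. of Math. 179 (2014), Thm. C, hypothesis (4). [BarnetlambEtAl2014]
-/

noncomputable section

open Matrix Field IsLocalRing

namespace Literature.NumberTheory.GaloisRepresentations

universe u v w

/-! ### Reductions of a residually absolutely irreducible representation -/

section Reduction

variable {F : Type*} [Field F] {O : ValuationSubring F} {G : Type*} [Group G] {n : ℕ}

/-- **Every reduction of a residually absolutely irreducible `ρ` is absolutely irreducible.**  If
some reduction `τ` of `ρ : G → GL_n(F)` over `O/𝔪` is absolutely irreducible, then so is every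
reduction `σ` over `O/𝔪`: `det(X - σ(g)) = det(X - τ(g))` (both reduce `det(X - ρ(g)) ∈ O[X]`,
`HasResidualCharpolys.charpoly_eq`), this persists after any `f : O/𝔪 → k'`, and irreducibility of
`GL_n(f) ∘ σ` follows from that of `GL_n(f) ∘ τ` (`isIrreducible_of_charpoly_eq`).
[cite: DarmonDiamondTaylor1995, §2.1, Prop. 2.6 (b)] -/
theorem IsReductionOf.isAbsIrreducible_of_isResiduallyAbsIrreducible {ρ : G →* GL (Fin n) F}
    {σ : G →* GL (Fin n) (ResidueField O)} (hσ : IsReductionOf (RingHom.id _) ρ σ)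
    (h : IsResiduallyAbsIrreducible O ρ) : IsAbsIrreducible σ := by
  intro k' _ f
  obtain ⟨τ, hτ, habs⟩ := h
  have hcp : ∀ g, ((σ g : GL (Fin n) (ResidueField O)) : Matrix (Fin n) (Fin n) (ResidueField O)).charpoly =
      ((τ g : GL (Fin n) (ResidueField O)) : Matrix (Fin n) (Fin n) (ResidueField O)).charpoly :=
    hσ.hasResidualCharpolys.charpoly_eq hτ.hasResidualCharpolys
  refine Literature.RepresentationTheory.Semisimple.isIrreducible_of_charpoly_eq _ _ (fun g => ?_)
    (habs k' f)
  rw [MonoidHom.comp_apply, MonoidHom.comp_apply, charpoly_generalLinearGroup_map,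
    charpoly_generalLinearGroup_map, hcp g]

end Reduction

/-! ### `Ind` commutes with reduction -/

section Induce

variable {p : ℕ} [Fact p.Prime] (K : Type u) {E : Type v} [Field K] [Field E] [Algebra K E]
  [CharZero K] [FiniteDimensional K E] {n d : ℕ}

/-- Entrywise maps commute with the flattening `reindex e e ∘ Matrix.comp` of block matrices.
[folklore] -/
theorem map_reindex_comp {ι : Type*} {R S : Type*} {m k : ℕ} (e : ι × Fin k ≃ Fin m)
    (M : Matrix ι ι (Matrix (Fin k) (Fin k) R)) (f : R → S) :
    (Matrix.reindex e e (Matrix.comp ι ι (Fin k) (Fin k) R M)).map f =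
      Matrix.reindex e e (Matrix.comp ι ι (Fin k) (Fin k) S (M.map fun B => B.map f)) := by
  ext x y
  rfl

namespace FramedGaloisRep

/-- A homomorphism with open kernel into a discrete group is continuous. [folklore] -/
theorem continuous_of_isOpen_ker {Γ H : Type*} [Group Γ] [TopologicalSpace Γ]
    [IsTopologicalGroup Γ] [Group H] [TopologicalSpace H] [ContinuousMul H] (σ : Γ →* H)
    (hker : IsOpen (σ.ker : Set Γ)) : Continuous σ := by
  -- adapted from `exists_framedGaloisRep_coe_eq_map_residualRep` (`ResidualRepScalarExtension`)
  refine continuous_of_continuousAt_one σ ?_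
  rw [ContinuousAt, map_one]
  refine Filter.tendsto_def.mpr fun W hW => Filter.mem_of_superset (hker.mem_nhds σ.ker.one_mem) ?_
  intro x hx
  rw [Set.mem_preimage, (MonoidHom.mem_ker).mp hx]
  exact mem_of_mem_nhds hW

/-- **`Ind` commutes with reduction.**  For a finite extension `E/K` of degree `d` (characteristic
`0`) and `W : Γ_E → GL_n(ℚ̄_p)` continuous, there is a continuous reduction
`τ : Γ_E → GL_n(ℤ̄_p/𝔪)` of `W` (discrete topology on `ℤ̄_p/𝔪`; a reduction has open kernel) such
that `Ind_{Γ_E}^{Γ_K} τ` is a reduction of `Ind_{Γ_E}^{Γ_K} W` (`FramedGaloisRep.induce`, the same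
coset representatives on both sides): with an integral model `W₀ = P⁻¹ W P`, the block matrices
`(Ẇ₀(rᵢ⁻¹ g rⱼ))` form an integral model `D⁻¹ Ind(W) D` of `Ind(W)` (`D = diag(P, …, P)`,
`FramedRep.induce_conj`) whose reduction is `Ind(W₀ mod 𝔪) = Ind(τ)`.
[cite: DarmonDiamondTaylor1995, §2.1, p. 54] [cite: SerreLinearRepresentations1977, §3.3 Thm. 12 (proof)] -/
theorem exists_isReductionOf_induce [TopologicalSpace (padicAlgClResidueField p)]
    [DiscreteTopology (padicAlgClResidueField p)] (hd : Module.finrank K E = d)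
    (W : FramedGaloisRep E (PadicAlgCl p) n) :
    ∃ τ : FramedGaloisRep E (padicAlgClResidueField p) n,
      W.IsReductionOf (RingHom.id _) (τ : absoluteGaloisGroup E →* GL (Fin n) (padicAlgClResidueField p)) ∧
      (W.induce K hd).IsReductionOf (RingHom.id _)
        (τ.induce K hd : absoluteGaloisGroup K →* GL (Fin (d * n)) (padicAlgClResidueField p)) := by
  classical
  haveI : CharZero E := charZero_of_injective_algebraMap (algebraMap K E).injective
  set O : ValuationSubring (PadicAlgCl p) := padicAlgClIntegers p with hO
  -- an integral model `W₀ = P⁻¹ W P` and its reduction `τb`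
  obtain ⟨P, W₀, hP⟩ :=
    exists_integralModel_of_valuationSubring (O := O) (Valued.isOpen_valuationSubring _) W
  set τb : absoluteGaloisGroup E →* GL (Fin n) (padicAlgClResidueField p) :=
    integralReduction (RingHom.id _) W₀ with hτb
  have hred : W.IsReductionOf (RingHom.id _) τb :=
    ⟨W₀, 1, ⟨P, hP⟩, fun g => by rw [one_mul, inv_one, mul_one]⟩
  -- `τb` is continuous for the discrete topology
  have hcont : Continuous τb := continuous_of_isOpen_ker τb (isOpen_ker_of_isReductionOf hred)
  let τ : FramedGaloisRep E (padicAlgClResidueField p) n := ⟨τb, hcont⟩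
  have hτ : ∀ g, τ g = τb g := fun g => rfl
  refine ⟨τ, hred, ?_⟩
  -- notation for the induction data
  have hφ : Function.Injective (absGaloisRestrict K E).toMonoidHom := absGaloisRestrict_injective K E
  set r := absGaloisCosetRep K E hd with hr
  have hrb := absGaloisCosetRep_bijective K E hd
  -- the conjugate `W' = P⁻¹ W P`, with entries those of `W₀`
  set W' : FramedGaloisRep E (PadicAlgCl p) n := FramedRep.conj P⁻¹ W with hW'
  have hW'₀ : ∀ g, (W' g : GL (Fin n) (PadicAlgCl p)) = Matrix.GeneralLinearGroup.map O.subtype (W₀ g) := by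
    intro g
    rw [hP g, hW', FramedRep.conj_apply, inv_inv]
  have hW'mat : (fun B : Matrix (Fin n) (Fin n) O => B.map O.subtype) ∘
      ((Units.coeHom _).comp W₀ : absoluteGaloisGroup E →* Matrix (Fin n) (Fin n) O) =
        FramedRep.toMatrixHom W' := by
    funext g
    rw [Function.comp_apply, FramedRep.toMatrixHom_apply, hW'₀ g]
    rfl
  -- the induced integral model `I₀`
  let flat : Matrix (Fin d) (Fin d) (Matrix (Fin n) (Fin n) O) →+* Matrix (Fin (d * n)) (Fin (d * n)) O :=
    ((Matrix.compRingEquiv (Fin d) (Fin n) O).trans (Matrix.reindexRingEquiv O finProdFinEquiv)).toRingHom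
  let I₀ : absoluteGaloisGroup K →* GL (Fin (d * n)) O :=
    (flat.toMonoidHom.comp (indMatrixHom hφ ((Units.coeHom _).comp W₀) r hrb)).toHomUnits
  have hI₀ : ∀ g, ((I₀ g : GL (Fin (d * n)) O) : Matrix (Fin (d * n)) (Fin (d * n)) O) =
      Matrix.reindex finProdFinEquiv finProdFinEquiv (Matrix.comp (Fin d) (Fin d) (Fin n) (Fin n) O
        (indMatrix (absGaloisRestrict K E).toMonoidHom ((Units.coeHom _).comp W₀) r g)) :=
    fun g => rfl
  -- `I₀ ⊗ ℚ̄_p = Ind(W')` entrywise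
  have hI₀W' : ∀ g, (((I₀ g : GL (Fin (d * n)) O) : Matrix (Fin (d * n)) (Fin (d * n)) O)).map O.subtype =
      ((W'.induce K hd g : GL (Fin (d * n)) (PadicAlgCl p)) :
        Matrix (Fin (d * n)) (Fin (d * n)) (PadicAlgCl p)) := by
    intro g
    rw [hI₀, map_reindex_comp,
      indMatrix_map hφ _ _ (fun B : Matrix (Fin n) (Fin n) O => B.map O.subtype)
        (Matrix.map_zero _ (map_zero _)), hW'mat]
    rfl
  -- `I₀ mod 𝔪 = Ind(τ)` entrywise
  have hI₀τ : ∀ g, (((I₀ g : GL (Fin (d * n)) O) : Matrix (Fin (d * n)) (Fin (d * n)) O)).map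
      (residue O) =
      ((τ.induce K hd g : GL (Fin (d * n)) (padicAlgClResidueField p)) :
        Matrix (Fin (d * n)) (Fin (d * n)) (padicAlgClResidueField p)) := by
    intro g
    have hτmat : (fun B : Matrix (Fin n) (Fin n) O => B.map (residue O)) ∘
        ((Units.coeHom _).comp W₀ : absoluteGaloisGroup E →* Matrix (Fin n) (Fin n) O) =
          FramedRep.toMatrixHom τ := by
      funext x
      rw [Function.comp_apply, FramedRep.toMatrixHom_apply, hτ, hτb, integralReduction,
        RingHom.id_comp]
      rfl
    rw [hI₀, map_reindex_comp,
      indMatrix_map hφ _ _ (fun B : Matrix (Fin n) (Fin n) O => B.map (residue O))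
        (Matrix.map_zero _ (map_zero _)), hτmat]
    rfl
  -- the frame `D = diag(P⁻¹, …, P⁻¹)` relating `Ind(W')` and `Ind(W)`
  set D : GL (Fin (d * n)) (PadicAlgCl p) :=
    Units.map (FramedRep.blockScalar (ι := Fin d) (n := n) finProdFinEquiv).toMonoidHom P⁻¹ with hD
  have hconj : W'.induce K hd = FramedRep.conj D (W.induce K hd) := by
    rw [hW', induce_def, induce_def]
    exact FramedRep.induce_conj _ _ _ _ _ P⁻¹ W
  refine ⟨I₀, 1, ⟨D⁻¹, fun g => Units.ext ?_⟩, fun g => Units.ext ?_⟩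
  · -- integral model: `I₀ ⊗ ℚ̄_p = Ind(W') = D Ind(W) D⁻¹`
    rw [inv_inv]
    change (((I₀ g : GL (Fin (d * n)) O) : Matrix (Fin (d * n)) (Fin (d * n)) O)).map O.subtype = _
    rw [hI₀W' g, hconj, FramedRep.conj_apply]
    rfl
  · -- reduction: `Ind(τ) = 1 · (I₀ mod 𝔪) · 1⁻¹`
    rw [one_mul, inv_one, mul_one, integralReduction, RingHom.id_comp, MonoidHom.comp_apply]
    exact (hI₀τ g).symm

end FramedGaloisRep

end Induce

/-! ### The residual Mackey criterion for a quadratic induction restricted to `Γ_L` -/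

section Residual

variable {p : ℕ} [Fact p.Prime] (K : Type u) {E : Type v} [Field K] [Field E] [Algebra K E]
  [CharZero K] [FiniteDimensional K E] [IsGalois K E] [CharZero E] {n : ℕ}

namespace FramedGaloisRep

/-- **`(Ind_{Γ_E}^{Γ_K} W)|_{Γ_L}` is residually absolutely irreducible** (quadratic `E/K`).  Let
`E/K` be a quadratic extension (characteristic `0`), `L/K` with `res(Γ_L)` normal in `Γ_K` and
`L ⊄ E` (`res(Γ_L) ⊄ res(Γ_E)`), `M/E` presenting `Γ_{EL}` (`res(Γ_M) = res⁻¹(res Γ_L)`, hypothesis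
`hM`; for `L = K(ζ_p)`, `M = E(ζ_p)`), and `W : Γ_E → GL_n(ℚ̄_p)` continuous such that
`W|_{Γ_M}` is residually absolutely irreducible and, for every `g ∈ Γ_K ∖ res(Γ_E)`, `W|_{Γ_M}` and
the conjugate `W^g|_{Γ_M}` are NOT residually congruent (the characteristic polynomials of their
reductions differ somewhere: `W̄|_{Γ_{EL}} ≄ W̄^c|_{Γ_{EL}}` even after semisimplification).  Then
`((W.induce K hd).restrictField L)` is residually absolutely irreducible: `Ind` commutes with
reduction (`exists_isReductionOf_induce`), every reduction of `W|_{Γ_M}` is absolutely irreducible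
(`IsReductionOf.isAbsIrreducible_of_isResiduallyAbsIrreducible`), residual non-congruence gives
different characteristic polynomials of the reduction (`isResiduallyCongruent_iff_charpoly_residualRep_eq`),
and Mackey's criterion over `ℤ̄_p/𝔪` and its extensions applies
(`isAbsolutelyIrreducible_restrictField_induce_of_finrank_eq_two`).
[cite: SerreLinearRepresentations1977, §7.4 Prop. 23 and Cor.]
[cite: BarnetlambEtAl2014, Thm. C, hypothesis (4)] -/
theorem isResiduallyAbsIrreducible_restrictField_induce_of_finrank_eq_two
    (hd : Module.finrank K E = 2) (W : FramedGaloisRep E (PadicAlgCl p) n)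
    (L : Type*) [Field L] [Algebra K L]
    (hnormal : ((absGaloisRestrict K L).range : Subgroup (absoluteGaloisGroup K)).Normal)
    (hLE : ¬ (absGaloisRestrict K L).range ≤ (absGaloisRestrict K E).range)
    (M : Type*) [Field M] [Algebra E M]
    (hM : ∀ σ : absoluteGaloisGroup E,
      σ ∈ (absGaloisRestrict E M).range ↔ absGaloisRestrict K E σ ∈ (absGaloisRestrict K L).range)
    (hirr : IsResiduallyAbsIrreducible (W.restrictField M))
    (hreg : ∀ g : absoluteGaloisGroup K, g ∉ (absGaloisRestrict K E).range →
      ¬ FramedRep.IsResiduallyCongruent (W.restrictField M) ((W.outerConj g).restrictField M)) :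
    IsResiduallyAbsIrreducible ((W.induce K hd).restrictField L) := by
  classical
  letI : TopologicalSpace (padicAlgClResidueField p) := ⊥
  haveI : DiscreteTopology (padicAlgClResidueField p) := ⟨rfl⟩
  obtain ⟨τ, hτW, hτI⟩ := exists_isReductionOf_induce K hd W
  -- `(Ind τ)|_{Γ_L}` is a reduction of `(Ind W)|_{Γ_L}`
  have hredL : GaloisRepresentations.IsReductionOf (RingHom.id _)
      (((W.induce K hd).restrictField L : FramedGaloisRep L (PadicAlgCl p) (2 * n)) :
        absoluteGaloisGroup L →* GL (Fin (2 * n)) (PadicAlgCl p))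
      (((τ.induce K hd).restrictField L : FramedGaloisRep L (padicAlgClResidueField p) (2 * n)) :
        absoluteGaloisGroup L →* GL (Fin (2 * n)) (padicAlgClResidueField p)) :=
    GaloisRepresentations.IsReductionOf.comp hτI (absGaloisRestrict K L).toMonoidHom
  -- `τ|_{Γ_M}` is a reduction of the residually absolutely irreducible `W|_{Γ_M}`
  have hredM : GaloisRepresentations.IsReductionOf (RingHom.id _)
      ((W.restrictField M : FramedGaloisRep M (PadicAlgCl p) n) :
        absoluteGaloisGroup M →* GL (Fin n) (PadicAlgCl p))
      ((τ.restrictField M : FramedGaloisRep M (padicAlgClResidueField p) n) :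
        absoluteGaloisGroup M →* GL (Fin n) (padicAlgClResidueField p)) :=
    GaloisRepresentations.IsReductionOf.comp hτW (absGaloisRestrict E M).toMonoidHom
  have hirrτ : FramedRep.IsAbsolutelyIrreducible (τ.restrictField M) :=
    hredM.isAbsIrreducible_of_isResiduallyAbsIrreducible hirr
  -- different residual characteristic polynomials from residual non-congruence
  have hregτ : ∀ g : absoluteGaloisGroup K, g ∉ (absGaloisRestrict K E).range →
      ∃ σ : absoluteGaloisGroup M, FramedRep.charpoly (τ.restrictField M) σ ≠
        FramedRep.charpoly ((τ.outerConj g).restrictField M) σ := by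
    intro g hg
    obtain ⟨W₀, Q, ⟨P, hP⟩, hQ⟩ := hτW
    have hO : ∀ x : PadicAlgCl p, x ∈ padicAlgClIntegers p ↔ ‖x‖ ≤ 1 :=
      padicAlgCl_mem_valuationSubring_iff p
    have hbridge := FramedRep.isResiduallyCongruent_iff_charpoly_residualRep_eq hO
      (ρ := W.restrictField M) (ρ' := (W.outerConj g).restrictField M)
      (ρ₀ := W₀.comp (absGaloisRestrict E M).toMonoidHom)
      (ρ₀' := W₀.comp ((absGaloisOuterConj K E g).toMonoidHom.comp
        (absGaloisRestrict E M).toMonoidHom))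
      (P := P) (P' := P) (fun σ => hP _) (fun σ => hP _)
    have hne := hreg g hg
    rw [hbridge, not_forall] at hne
    obtain ⟨σ, hσ⟩ := hne
    refine ⟨σ, fun heq => hσ ?_⟩
    have hcp : ∀ x : absoluteGaloisGroup E,
        ((τ x : GL (Fin n) (padicAlgClResidueField p)) :
            Matrix (Fin n) (Fin n) (padicAlgClResidueField p)).charpoly =
          (((Matrix.GeneralLinearGroup.map (residue (padicAlgClIntegers p))).comp W₀ x :
              GL (Fin n) (padicAlgClResidueField p)) :
            Matrix (Fin n) (Fin n) (padicAlgClResidueField p)).charpoly := by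
      intro x
      have h1 := congrArg (fun X : GL (Fin n) (padicAlgClResidueField p) =>
        (X : Matrix (Fin n) (Fin n) (padicAlgClResidueField p)).charpoly) (hQ x)
      simp only [Units.val_mul, Matrix.coe_units_inv, Matrix.charpoly_units_conj] at h1
      rw [integralReduction, RingHom.id_comp] at h1
      exact h1
    have h2 : ((τ (absGaloisRestrict E M σ) : GL (Fin n) (padicAlgClResidueField p)) :
          Matrix (Fin n) (Fin n) (padicAlgClResidueField p)).charpoly =
        ((τ (absGaloisOuterConj K E g (absGaloisRestrict E M σ)) :
            GL (Fin n) (padicAlgClResidueField p)) :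
          Matrix (Fin n) (Fin n) (padicAlgClResidueField p)).charpoly := heq
    rw [hcp, hcp] at h2
    exact h2
  exact ⟨_, hredL,
    isAbsolutelyIrreducible_restrictField_induce_of_finrank_eq_two K hd τ L hnormal hLE M hM
      hirrτ hregτ⟩

end FramedGaloisRep

end Residual

end Literature.NumberTheory.GaloisRepresentations

end
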